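import Summits.Ventures.MM22.Rank333.Root21Discharge
import Summits.Ventures.MM22.Rank333.Lift333O479
import Summits.Ventures.MM22.Rank333.Lift333O484
import Summits.Ventures.MM22.Rank333.Lift333O486
import Summits.Ventures.MM22.Rank333.Lift333O487
import Summits.Ventures.MM22.Rank333.Lift333O488
import Summits.Ventures.MM22.Rank333.Lift333O489
import Summits.Ventures.MM22.Rank333.Lift333O490
import Summits.Ventures.MM22.Rank333.Lift333O491
import HarnessLib

/-!
# MM22 venture — «ROOT ⟸ 480» with every lifted plane bound discharged by the kernel

HONEST FRAMING (cell `pub-mm22`, seat p3 g4; v4 item (C), kernel form). Bench g5's CONDITIONAL theorem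
`Root21.rankGe21F2_of_480_lp_of_lifts` (`Root21Discharge.lean`: nine `Cert` hypotheses — orbit 480 of Wang's `⟨3,3,3⟩/𝔽₂` table
(arXiv:2603.07280) at 19, and the cell's eight LIFTED plane bounds 479, 484, 486, 488, 489, 487, 490, 491 at 19) now has all eight
lifted hypotheses discharged by KERNEL theorems: the lift certificates of the cell's cascade (p1 `p1dfs.c` / p2 `lpdfs2.c`,
`certificates/cascade/`) replayed in Lean (`Lift333O*.lean`, seat p3 g4: `Lift333.lift_479`, …, `Lift333.lift_491`, each an
unconditional `Cert 3 3 3 K 19` with `K` = Wang's constraint list of the orbit). What remains is EXACTLY ONE hypothesis: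
`Cert 3 3 3 [1, 16] 19` — orbit 480 at 19 (Wang prints 18; the cell's conjecture C1; NO certificate exists). This file proves no bound
on `⟨3,3,3⟩`: `RankGe21F2` stays OPEN; the kernel value of record is `20 ≤ R_{𝔽₂}(⟨3,3,3⟩)` (`twenty_le_tensorRank_matMulTensor_three_F2`).
-/

namespace Summit.Ventures.MM22.GF2Cert.Root21

open Summit.MatrixMultiplication.OmegaCensus.GF2RankLB Literature.Computability.AlgebraicComplexity
open Summit.Ventures.MM22.GF2Cert Summit.Ventures.MM22 Summit.Ventures.MM22.GF2Cert.Lift333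

/-- **«ROOT ⟸ 480», one-hypothesis kernel form** (CONDITIONAL): if every bilinear computation over `𝔽₂` of `(X, Y) ↦ X Y` on
`S_{[1,16]} × 𝔽₂^{3×3}` (orbit 480 of Wang's table) has at least 19 products, then `21 ≤ R_{𝔽₂}(⟨3,3,3⟩)`. All other inputs of
bench's weighted clique-cover argument — the eight lifted plane bounds at 19 and the printed point bounds 492/493/494 at 19 — are
kernel theorems (`Lift333O*.lean`, `Wang333TopCerts.lean`). -/
theorem rankGe21F2_of_cert480 (h480 : Cert 3 3 3 [1, 16] 19) : RankGe21F2 :=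
  rankGe21F2_of_480_lp_of_lifts h480 lift_479 lift_484 lift_486 lift_488 lift_489 lift_487 lift_490 lift_491

/-- The same, unfolded: `Cert 3 3 3 [1, 16] 19 → 21 ≤ tensorRank (matMulTensor (ZMod 2) 3 3 3)`. -/
theorem twentyone_le_tensorRank_of_cert480 (h480 : Cert 3 3 3 [1, 16] 19) :
    21 ≤ tensorRank (matMulTensor (ZMod 2) 3 3 3) :=
  rankGe21F2_of_cert480 h480

end Summit.Ventures.MM22.GF2Cert.Root21
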